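import Summits.QuantumFields.YangMills.Theorems.BalabanUVNodesPortS1JacDomTower

/-!
# Crux `PortRecordRepresentationS1` (stmt-QuantumFields-27930), line `pta-residueW` (skeleton v3.1) — REGISTERED STUB `stub_LZjacDom` LANDED: `∀ F, JacRowsABDom F` (rows (a)(b) of the
# torus Jacobian functional `J_T(c, ·)` at every tower-loop-small `SL(2,ℂ)` field, `a := 1∕(5168·576·L⁴)`, `E := 2`), by `…JacDomTower.jacRowsABDom_holds`

Cell `ym-nodeO-ideate`, porter seat `ymgap-nodeO-port-PTA-1` (gen 7, lead of the line); `--supports stmt-QuantumFields-27930` (stub credit: proves the registered stub BY NAME AND SIGNATURE).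
After this file the skeleton `Cruxes/PortRecordRepresentationS1/Lines/pta_residueW.lean` has TWO open stubs: `stub_LZdet` (BLOCKED-ON P0 (α)+(β), ⟨stmt-QuantumFields-26900⟩) and `stub_FE`
(XXL); with `stub_LZjacKStep` (✓p817566) the whole δ-Jacobian bracket `PortRecordLZjacHalf` of `log Z^{(k)}` is now a THEOREM (`…JacGlue.lzjacHalf_of_jacRowsAB` ∘
`…JacKStepGlue.jacRowsAB_of_kstep_of_dom`).

HONEST FRAMING.  One more registered stub is proved — by LOCALIZATION and COMPOSITION of landed theorems (PTZ-1's one-step response estimate re-run for the component block, dag-n12-c's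
tower analyticity and two-block locality, gen 6's cover bridge, dag-n07-w2's (0.8) estimate); NOTHING of Bałaban's renormalization-group estimates asserted or re-proved; the crux 27930 ⁸-Ax-LR4
is OPEN · no claim; K0⁷∕K-Ax OPEN; NODE O 0∕1; COUNT 8∕28 · K 1∕4 UNMOVED; finite `𝕋⁴_{L^K}` at fixed ε — NOT continuum ∕ OS ∕ Clay; **the Yang–Mills mass gap is NOT proved by any of
this.**  No `sorry`; standard axioms.
-/

namespace Summit.QuantumFields.YangMills.Theorems.BalabanUVNodesPortS1

/-- ★★★ **REGISTERED STUB `stub_LZjacDom` OF THE LINE `pta-residueW`**: rows (a)(b) of the torus Jacobian functional on the tower-loop-small `SL(2,ℂ)` domain hold for every torus family.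
[cite: Balaban1987RG1, p.267–268 («h(c)» analytic), (1.18) p.263, (0.4) p.253; Balaban1985Variational, Prop. 9 p.309] -/
theorem stub_LZjacDom : ∀ F, Summit.QuantumFields.YangMills.Theorems.BalabanUVNodesPortS1.JacRowsABDom F :=
  fun F => jacRowsABDom_holds F

end Summit.QuantumFields.YangMills.Theorems.BalabanUVNodesPortS1
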